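import Summits.Ventures.PercRepro.RankLevelSetIndepCD
import Summits.Ventures.PercRepro.RankLevelSetIndepNMP
import Summits.Ventures.PercRepro.RankLevelSetBiIndepLRSum

/-! # RankLevelSetIndepCDSum — THE (CD)-CLASS IS CLOSED UNDER DIRECT SUMS (GIVEN THE LOG-CONCAVITY OF THE SUMMAND'S
INDEPENDENCE PROFILE) (night-1 g27; dossier §39.9)

For disjoint finite matroids `M, N` and `e ∈ E_M` the contraction/deletion profiles of `M ⊕ N` at `e` are the
convolutions of those of `M` with the independence profile `I_k(N) = indepLevelCount N k`:
`x_p(M ⊕ N; e) = Σ_a x_a(M; e) · I_{p−a}(N)` and `y_p(M ⊕ N; e) = Σ_a y_a(M; e) · I_{p−a}(N)`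
(`contractCount_disjointSum`, `deleteCount_disjointSum`; fibrewise by the size of the `M`-trace, as in
`RankLevelSetBiIndepSum`). THE NAMED FACT `IndepPF2 N` (a `Prop`, NOT proved here): the independence profile of `N`
is log-concave in the all-spreads form `I_{x−k} · I_{y+k} ≤ I_x · I_y` (`x ≤ y`, `k ≤ x`) — Mason's conjecture in
its log-concave form, a theorem of the published literature [Anari–Liu–Oveis Gharan–Vinzant, Log-concave polynomials
III, 2018; Brändén–Huh, Lorentzian polynomials, Ann. of Math. 192 (2020)] (references quoted from memory, the
literature tool being down in this sparse root); log-concavity with the interval support `0 ≤ k ≤ rank` gives the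
spread form. A PF₂ profile has a TP2 truncated Toeplitz kernel (`indepKer_tp2`, the proof of g26's `convKer_tp2`),
and the 2-row Cauchy–Binet `tp2_conv` of `RankLevelSetBiIndepLRSum` composes: **`indepCD_disjointSum :
IndepCD M → IndepCD N → IndepPF2 M → IndepPF2 N → IndepCD (M ⊕ N)`** — the same closure theory as for (LR). Nothing
here asserts (CD) or the named fact; every declaration has a docstring; imports: the cell's own modules and Mathlib
only. Axioms: standard. -/

namespace PercRepro

open Set Matroid Finset

variable {α : Type}

/-- **THE NAMED FACT (all-spreads log-concavity of the independence profile)** — a `Prop`, NOT proved here: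
`I_{x−k}(N) · I_{y+k}(N) ≤ I_x(N) · I_y(N)` for `x ≤ y`, `k ≤ x` (Mason's log-concavity, ALOV 2018 / Brändén–Huh 2020,
with the interval support of the profile). -/
def IndepPF2 (N : Matroid α) : Prop :=
  ∀ x y k : ℕ, x ≤ y → k ≤ x →
    indepLevelCount N (x - k) * indepLevelCount N (y + k) ≤ indepLevelCount N x * indepLevelCount N y

/-- The truncated Toeplitz kernel of the independence profile: `K(p, i) = I_{p−i}(N)` for `i ≤ p`, else `0`. -/
noncomputable def indepKer (N : Matroid α) (p i : ℕ) : ℕ :=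
  if i ≤ p then indepLevelCount N (p - i) else 0

/-- **A PF₂ independence profile has a TP2 kernel**: `K(q,i)·K(p,j) ≤ K(p,i)·K(q,j)` for `i ≤ j`, `p ≤ q`. -/
lemma indepKer_tp2 {N : Matroid α} (hN : IndepPF2 N) {p q i j : ℕ} (hpq : p ≤ q) (hij : i ≤ j) :
    indepKer N q i * indepKer N p j ≤ indepKer N p i * indepKer N q j := by
  unfold indepKer
  by_cases hjp : j ≤ p
  · have hip : i ≤ p := hij.trans hjp
    have hiq : i ≤ q := hip.trans hpq
    have hjq : j ≤ q := hjp.trans hpq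
    simp only [hip, hiq, hjp, hjq, if_true]
    by_cases hcase : j - i ≤ q - p
    · have h := hN (p - i) (q - j) (j - i) (by omega) (by omega)
      rw [show p - i - (j - i) = p - j by omega, show q - j + (j - i) = q - i by omega] at h
      calc indepLevelCount N (q - i) * indepLevelCount N (p - j)
          = indepLevelCount N (p - j) * indepLevelCount N (q - i) := mul_comm _ _
        _ ≤ indepLevelCount N (p - i) * indepLevelCount N (q - j) := h
    · have h := hN (q - j) (p - i) (q - p) (by omega) (by omega)
      rw [show q - j - (q - p) = p - j by omega, show p - i + (q - p) = q - i by omega] at h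
      calc indepLevelCount N (q - i) * indepLevelCount N (p - j)
          = indepLevelCount N (p - j) * indepLevelCount N (q - i) := mul_comm _ _
        _ ≤ indepLevelCount N (q - j) * indepLevelCount N (p - i) := h
        _ = indepLevelCount N (p - i) * indepLevelCount N (q - j) := mul_comm _ _
  · simp only [hjp, if_false, mul_zero]
    exact Nat.zero_le _


/-- **Telescoping a consecutive TP2 condition** on two sequences `a, b : ℕ → ℕ`: if `a (k+1) b k ≤ a k b (k+1)` for
every `k` and `b` is positive on `[p, q]`, then `a q b p ≤ a p b q`. -/
lemma tp2_telescope {a b : ℕ → ℕ} (hstep : ∀ k, a (k + 1) * b k ≤ a k * b (k + 1)) {p q : ℕ} (hpq : p ≤ q)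
    (hpos : ∀ k, p ≤ k → k ≤ q → 0 < b k) : a q * b p ≤ a p * b q := by
  induction q, hpq using Nat.le_induction with
  | base => exact le_rfl
  | succ q hpq ih =>
    have ih' := ih (fun k hk hk' => hpos k hk (by omega))
    have hs := hstep q
    have hbq : 0 < b q := hpos q hpq (by omega)
    have h1 : a (q + 1) * b p * b q ≤ a p * b (q + 1) * b q := by
      calc a (q + 1) * b p * b q = (a (q + 1) * b q) * b p := by ring
        _ ≤ (a q * b (q + 1)) * b p := Nat.mul_le_mul_right _ hs
        _ = (a q * b p) * b (q + 1) := by ring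
        _ ≤ (a p * b q) * b (q + 1) := Nat.mul_le_mul_right _ ih'
        _ = a p * b (q + 1) * b q := by ring
    exact Nat.le_of_mul_le_mul_right h1 hbq

variable (M : Matroid α) [M.Finite]

/-- `x_k ≤ y_k`: a set with `T ∪ {e}` independent is independent. -/
lemma contractCount_le_deleteCount (e : α) (k : ℕ) : contractCount M e k ≤ deleteCount M e k := by
  unfold contractCount deleteCount
  refine Set.ncard_le_ncard (fun T hT => ⟨hT.1, hT.2.1, hT.2.2.subset (Set.subset_insert e T)⟩) ?_
  exact (M.ground_finite.subset Set.sdiff_subset).finite_subsets.subset (fun T hT => hT.1)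

/-- The deletion profile has interval support: `y_j > 0` and `k ≤ j` give `y_k > 0` (take a `k`-subset of a witness). -/
lemma deleteCount_pos_of_le (e : α) {j k : ℕ} (hkj : k ≤ j) (hj : 0 < deleteCount M e j) :
    0 < deleteCount M e k := by
  obtain ⟨T, hTE, hTcard, hTind⟩ := Set.nonempty_of_ncard_ne_zero (Nat.pos_iff_ne_zero.mp hj)
  obtain ⟨S, hST, hScard⟩ := Set.exists_subset_card_eq (hTcard ▸ hkj : k ≤ T.ncard)
  have hmem : S ∈ {T : Set α | T ⊆ M.E \ {e} ∧ T.ncard = k ∧ M.Indep T} := ⟨hST.trans hTE, hScard, hTind.subset hST⟩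
  unfold deleteCount
  exact Set.ncard_pos ((M.ground_finite.subset Set.sdiff_subset).finite_subsets.subset (fun T hT => hT.1)) |>.mpr
    ⟨S, hmem⟩

/-- **The all-pairs form of (CD)**: `x_j · y_i ≤ x_i · y_j` for `i ≤ j` (telescoping on the positive part of the
deletion profile; beyond it `x_j ≤ y_j = 0`). -/
lemma indepCD_all_pairs (hM : IndepCD M) {e : α} (he : e ∈ M.E) {i j : ℕ} (hij : i ≤ j) :
    contractCount M e j * deleteCount M e i ≤ contractCount M e i * deleteCount M e j := by
  by_cases hj : deleteCount M e j = 0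
  · have : contractCount M e j = 0 := Nat.eq_zero_of_le_zero (hj ▸ contractCount_le_deleteCount M e j)
    rw [this, zero_mul]; exact Nat.zero_le _
  · exact tp2_telescope (a := contractCount M e) (b := deleteCount M e) (fun k => hM e he k) hij
      (fun k _ hk => deleteCount_pos_of_le M e hk (Nat.pos_of_ne_zero hj))

variable (N : Matroid α) [N.Finite]

/-- **The convolution of a trace-filtered count**: for a predicate `Q` on the `M`-trace,
`#{T ⊆ (E_M ∪ E_N) ∖ {e} : #T = p, Q (T ∩ E_M), N.Indep (T ∩ E_N)} = Σ_{a ≤ p} #{T₁ ⊆ E_M ∖ {e} : #T₁ = a, Q T₁} · I_{p−a}(N)`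
(`e ∈ E_M`). -/
theorem ncard_trace_disjointSum (h : Disjoint M.E N.E) (Q : Set α → Prop) {e : α} (he : e ∈ M.E) (p : ℕ) :
    {T : Set α | T ⊆ (M.E ∪ N.E) \ {e} ∧ T.ncard = p ∧ Q (T ∩ M.E) ∧ N.Indep (T ∩ N.E)}.ncard =
      ∑ a ∈ Finset.range (p + 1),
        {T₁ : Set α | T₁ ⊆ M.E \ {e} ∧ T₁.ncard = a ∧ Q T₁}.ncard * indepLevelCount N (p - a) := by
  classical
  set 𝒮 : Set (Set α) :=
    {T : Set α | T ⊆ (M.E ∪ N.E) \ {e} ∧ T.ncard = p ∧ Q (T ∩ M.E) ∧ N.Indep (T ∩ N.E)} with h𝒮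
  have hEfin : (M.E ∪ N.E).Finite := M.ground_finite.union N.ground_finite
  have h𝒮fin : 𝒮.Finite :=
    hEfin.finite_subsets.subset (fun T hT => hT.1.trans Set.sdiff_subset)
  have hmaps : ∀ T ∈ h𝒮fin.toFinset, (T ∩ M.E).ncard ∈ Finset.range (p + 1) := by
    intro T hT
    rw [h𝒮fin.mem_toFinset] at hT
    rw [Finset.mem_range, Nat.lt_succ_iff, ← hT.2.1]
    exact Set.ncard_le_ncard Set.inter_subset_left (hEfin.subset (hT.1.trans Set.sdiff_subset))
  rw [Set.ncard_eq_toFinset_card 𝒮 h𝒮fin, Finset.card_eq_sum_card_fiberwise hmaps]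
  refine Finset.sum_congr rfl (fun a ha => ?_)
  rw [Finset.mem_range, Nat.lt_succ_iff] at ha
  unfold indepLevelCount
  rw [← Set.ncard_coe_finset, ← Set.ncard_prod]
  refine Set.ncard_congr (fun T _ => (T ∩ M.E, T ∩ N.E)) ?_ ?_ ?_
  · intro T hT
    obtain ⟨hT1, hTa⟩ := Finset.mem_filter.mp (Finset.mem_coe.mp hT)
    obtain ⟨hTE, hTcard, hQ, hNind⟩ := h𝒮fin.mem_toFinset.mp hT1
    have hTE' : T ⊆ M.E ∪ N.E := hTE.trans Set.sdiff_subset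
    have hsplit := ncard_eq_ncard_inter_add_ncard_inter h hTE' (hEfin.subset hTE')
    refine Set.mem_prod.mpr ⟨⟨?_, hTa, hQ⟩, ⟨Set.inter_subset_right, ?_, hNind⟩⟩
    · intro x hx
      exact ⟨hx.2, fun hxe => (hTE hx.1).2 hxe⟩
    · show (T ∩ N.E).ncard = p - a
      omega
  · intro T T' hT hT' hTT'
    simp only [Prod.mk.injEq] at hTT'
    obtain ⟨hT1, -⟩ := Finset.mem_filter.mp (Finset.mem_coe.mp hT)
    obtain ⟨hT'1, -⟩ := Finset.mem_filter.mp (Finset.mem_coe.mp hT')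
    have hTE : T ⊆ M.E ∪ N.E := (h𝒮fin.mem_toFinset.mp hT1).1.trans Set.sdiff_subset
    have hT'E : T' ⊆ M.E ∪ N.E := (h𝒮fin.mem_toFinset.mp hT'1).1.trans Set.sdiff_subset
    ext x
    constructor
    · intro hx
      rcases hTE hx with hxM | hxN
      · have hx' : x ∈ T' ∩ M.E := hTT'.1 ▸ ⟨hx, hxM⟩
        exact hx'.1
      · have hx' : x ∈ T' ∩ N.E := hTT'.2 ▸ ⟨hx, hxN⟩
        exact hx'.1
    · intro hx
      rcases hT'E hx with hxM | hxN
      · have hx' : x ∈ T ∩ M.E := hTT'.1.symm ▸ ⟨hx, hxM⟩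
        exact hx'.1
      · have hx' : x ∈ T ∩ N.E := hTT'.2.symm ▸ ⟨hx, hxN⟩
        exact hx'.1
  · rintro ⟨T₁, T₂⟩ hpair
    rw [Set.mem_prod] at hpair
    obtain ⟨⟨hT₁E, hT₁card, hQ⟩, hT₂E, hT₂card, hT₂ind⟩ := hpair
    have hT₁E' : T₁ ⊆ M.E := hT₁E.trans Set.sdiff_subset
    have hdisj : Disjoint T₁ T₂ := Set.disjoint_of_subset hT₁E' hT₂E h
    have e₁ : (T₁ ∪ T₂) ∩ M.E = T₁ := by
      rw [Set.union_inter_distrib_right, Set.inter_eq_self_of_subset_left hT₁E',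
        (Set.disjoint_of_subset_left hT₂E h.symm).inter_eq, Set.union_empty]
    have e₂ : (T₁ ∪ T₂) ∩ N.E = T₂ := by
      rw [Set.union_inter_distrib_right, Set.inter_eq_self_of_subset_left hT₂E,
        (Set.disjoint_of_subset_left hT₁E' h).inter_eq, Set.empty_union]
    refine ⟨T₁ ∪ T₂, ?_, ?_⟩
    · rw [Finset.mem_coe, Finset.mem_filter, h𝒮fin.mem_toFinset]
      refine ⟨⟨?_, ?_, by rw [e₁]; exact hQ, by rw [e₂]; exact hT₂ind⟩, by rw [e₁]; exact hT₁card⟩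
      · intro x hx
        rcases hx with hx | hx
        · exact ⟨Or.inl (hT₁E hx).1, (hT₁E hx).2⟩
        · refine ⟨Or.inr (hT₂E hx), fun hxe => ?_⟩
          rw [Set.mem_singleton_iff] at hxe
          exact Set.disjoint_left.mp h he (hxe ▸ hT₂E hx)
      · rw [Set.ncard_union_eq hdisj (M.ground_finite.subset hT₁E') (N.ground_finite.subset hT₂E), hT₁card,
          hT₂card]
        omega
    · simp only [e₁, e₂]

omit [M.Finite] [N.Finite] in
/-- A sum over `range (p + 1)` with `I_{p−a}(N)` is the same sum over any larger `range (q + 1)` with the kernel. -/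
lemma sum_range_indepKer (X : ℕ → ℕ) {p q : ℕ} (hpq : p ≤ q) :
    ∑ a ∈ Finset.range (p + 1), X a * indepLevelCount N (p - a) =
      ∑ a ∈ Finset.range (q + 1), X a * indepKer N p a := by
  have e1 : ∑ a ∈ Finset.range (p + 1), X a * indepLevelCount N (p - a) =
      ∑ a ∈ Finset.range (p + 1), X a * indepKer N p a := by
    refine Finset.sum_congr rfl (fun a ha => ?_)
    rw [Finset.mem_range] at ha
    simp only [indepKer, show a ≤ p by omega, if_true]
  rw [e1]
  apply Finset.sum_subset (Finset.range_mono (by omega : p + 1 ≤ q + 1))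
  intro a ha ha'
  rw [Finset.mem_range] at ha ha'
  simp only [indepKer, show ¬ a ≤ p by omega, if_false, mul_zero]

/-- **The contraction profile of `M ⊕ N` at `e ∈ E_M` convolves**: `x_p(M ⊕ N; e) = Σ_a x_a(M; e) · K(p, a)`. -/
lemma contractCount_disjointSum (h : Disjoint M.E N.E) {e : α} (he : e ∈ M.E) {p q : ℕ} (hpq : p ≤ q) :
    contractCount (M.disjointSum N h) e p = ∑ a ∈ Finset.range (q + 1), contractCount M e a * indepKer N p a := by
  have heN : e ∉ N.E := fun hmem => Set.disjoint_left.mp h he hmem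
  have e1 : contractCount (M.disjointSum N h) e p =
      {T : Set α | T ⊆ (M.E ∪ N.E) \ {e} ∧ T.ncard = p ∧ M.Indep (insert e (T ∩ M.E)) ∧ N.Indep (T ∩ N.E)}.ncard := by
    unfold contractCount
    congr 1
    ext T
    simp only [Set.mem_setOf_eq, Matroid.disjointSum_ground_eq, Matroid.disjointSum_indep_iff]
    have i₁ : insert e T ∩ M.E = insert e (T ∩ M.E) := by
      rw [Set.insert_inter_of_mem he]
    have i₂ : insert e T ∩ N.E = T ∩ N.E := by
      rw [Set.insert_inter_of_notMem heN]
    rw [i₁, i₂]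
    constructor
    · rintro ⟨hTE, hT, hM, hN, -⟩; exact ⟨hTE, hT, hM, hN⟩
    · rintro ⟨hTE, hT, hM, hN⟩
      exact ⟨hTE, hT, hM, hN, Set.insert_subset (Or.inl he) (hTE.trans Set.sdiff_subset)⟩
  rw [e1, ncard_trace_disjointSum M N h (fun T₁ => M.Indep (insert e T₁)) he p]
  exact sum_range_indepKer N (fun a => contractCount M e a) hpq

/-- **The deletion profile of `M ⊕ N` at `e ∈ E_M` convolves**: `y_p(M ⊕ N; e) = Σ_a y_a(M; e) · K(p, a)`. -/
lemma deleteCount_disjointSum (h : Disjoint M.E N.E) {e : α} (he : e ∈ M.E) {p q : ℕ} (hpq : p ≤ q) :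
    deleteCount (M.disjointSum N h) e p = ∑ a ∈ Finset.range (q + 1), deleteCount M e a * indepKer N p a := by
  have e1 : deleteCount (M.disjointSum N h) e p =
      {T : Set α | T ⊆ (M.E ∪ N.E) \ {e} ∧ T.ncard = p ∧ M.Indep (T ∩ M.E) ∧ N.Indep (T ∩ N.E)}.ncard := by
    unfold deleteCount
    congr 1
    ext T
    simp only [Set.mem_setOf_eq, Matroid.disjointSum_ground_eq, Matroid.disjointSum_indep_iff]
    constructor
    · rintro ⟨hTE, hT, hM, hN, -⟩; exact ⟨hTE, hT, hM, hN⟩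
    · rintro ⟨hTE, hT, hM, hN⟩
      exact ⟨hTE, hT, hM, hN, hTE.trans Set.sdiff_subset⟩
  rw [e1, ncard_trace_disjointSum M N h (fun T₁ => M.Indep T₁) he p]
  exact sum_range_indepKer N (fun a => deleteCount M e a) hpq

/-- **(CD) at an element of the first summand**: if `M` satisfies (CD) at `e ∈ E_M` and the independence profile of
`N` is PF₂, then `M ⊕ N` satisfies (CD) at `e`. -/
theorem indepCD_disjointSum_left (h : Disjoint M.E N.E) (hM : IndepCD M) (hN : IndepPF2 N) {e : α} (he : e ∈ M.E) (k : ℕ) :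
    contractCount (M.disjointSum N h) e (k + 1) * deleteCount (M.disjointSum N h) e k ≤
      contractCount (M.disjointSum N h) e k * deleteCount (M.disjointSum N h) e (k + 1) := by
  rw [contractCount_disjointSum M N h he (le_refl (k + 1)), deleteCount_disjointSum M N h he (Nat.le_succ k),
    contractCount_disjointSum M N h he (Nat.le_succ k), deleteCount_disjointSum M N h he (le_refl (k + 1))]
  refine tp2_conv (a := contractCount M e) (b := deleteCount M e) (K := indepKer N) (p := k) (q := k + 1)
    (fun i j hij => ?_) (fun i j hij => indepKer_tp2 hN (Nat.le_succ k) hij) (Finset.range (k + 2))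
  exact indepCD_all_pairs M hM he hij

/-- **THE (CD)-CLASS WITH PF₂ PROFILES IS CLOSED UNDER DIRECT SUMS**:
`IndepCD M → IndepCD N → IndepPF2 M → IndepPF2 N → IndepCD (M ⊕ N)`. -/
theorem indepCD_disjointSum (h : Disjoint M.E N.E) (hM : IndepCD M) (hN : IndepCD N) (hM2 : IndepPF2 M) (hN2 : IndepPF2 N) :
    IndepCD (M.disjointSum N h) := by
  intro e he k
  rw [Matroid.disjointSum_ground_eq] at he
  rcases he with heM | heN
  · exact indepCD_disjointSum_left M N h hM hN2 heM k
  · have e : M.disjointSum N h = N.disjointSum M h.symm := Matroid.disjointSum_comm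
    rw [e]
    exact indepCD_disjointSum_left N M h.symm hN hM2 heN k

end PercRepro
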